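import Literature.AlgebraicGeometry.ModuliOfAbelianVarieties.SiegelFineModuliSchemeOfCores   -- ★ p796022 F-12-of-cores ED. 3 `exists_threshold_siegelFineModuliScheme_of_cores''` ([MumfordFogartyKirwan1994] Thm. 7.9 «for `n` large»; F0P1a-p01 (g2), Q7)
import Literature.AlgebraicGeometry.ModuliOfAbelianVarieties.SiegelFineModuliSchemeLevelDescent   -- ★ p766238 F-10 LEVEL DESCENT `lan2013_siegelFineModuliScheme_of_large_levels` (remark after Thm. 7.9, Lemma 7.11)
import Literature.AlgebraicGeometry.AbelianSchemes.LinearRigidificationStepTwo   -- ★ p796432 F23 CORE II `AbelianSchemeOver.exists_groupLawLocus_of_projective` ([MumfordFogartyKirwan1994] Prop. 6.16 ∕ Thm. 6.14 step (II); F0P1a-p02 (g2))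
import Summits.HodgeConjecture.HodgeConjecture.Theorems.F3DualAbelianSchemeStubF3   -- ★ p797885 T4 CORE F3 `…F3DualAbelianScheme.stub_F3_holds` ([MumfordFogartyKirwan1994] Cor. 6.8; F0P1c-p06 (g2) over (Z) (L) (K) (M))
import Summits.HodgeConjecture.HodgeConjecture.Theorems.F13PluckerProducerStubPL   -- ★ p795314 (ED. 2 ★ p796000) CORE PL `…F13PluckerProducer.stub_PL_of_cores_holds'` ([MumfordFogartyKirwan1994] Prop. 7.4 + §7.2 (*); F0-typ2 (g0))
import Summits.HodgeConjecture.HodgeConjecture.Theorems.F11SmoothRoadAStubF11   -- ★ p806948 CORE F11 `…F11SmoothRoadA.stub_F11_holds` ([Lan2013PELCompactifications] Prop. 2.2.4.4 ∕ Thm. 2.2.4.14, deformation road A; B-p05 (g20), F0P1b-plan (g2) (R124)∕(R126)(c), over ★ MONO-G1 + ★ MONO-G2)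
import Summits.HodgeConjecture.HodgeConjecture.Theorems.EquidimRelDimOfF   -- ★ p755621 E-road junction `EquidimRelDimOfF.HDel_of_F_E : lan2013_siegelFineModuliScheme → HDel` (crux decl by name)
import HarnessLib

/-!
# THE CLOSER OF ITEM stmt-HodgeConjecture-24835 — `HDel_holds : Summit.HodgeConjecture.HodgeConjecture.Theses.HCCMUnconditional.HDel`

Summit `HodgeConjecture`, sub-problem `HodgeConjecture`, route `HCCMUnconditional`, crux item stmt-HodgeConjecture-24835 (`HDel`:
[Deligne1979ShimuraVarieties, 2.2.5 ∕ Cor. 2.7.21] — the canonical model of the unitary Shimura datum exists as printed, binder `hDel`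
of the printed-citation form of HC_CM).  Cell `hodgecm-mathlib`, programme HC_CM FLOOR 0 (D-0183).  HONEST LABEL: HC_CM is proved only
modulo the 7 printed citations until rung 0 closes; THIS file discharges the citation `hDel` on Mathlib and the ★ Literature ∕ Theorems
files alone (axioms = the Lean trio) and says nothing about Hodge classes beyond that.

WHAT IT IS.  The Theorems-homed TWIN of the registry of item 24835, `Cruxes/HDel/Lines/F1ExtHodgeType.lean` (v5.9 «Q-F3»
1bf4da17f01f98a7 ∕ v5.10 «Q-F11»), whose head `HDel_proof` is sorry-free once its last registered letter `stub_F11` is the ★ theorem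
`Summit.HodgeConjecture.CorCM.Cruxes.HypDel.F11SmoothRoadA.stub_F11_holds` (`Theorems/F11SmoothRoadAStubF11`).  Crux workfiles under
`Cruxes/…/Lines` are not built on the farm and are never imported (EDITION-BOOK RULING 2026-08-30 23:10:50Z; director g14 s347 ∕ s418), and the
gate's `dedup.landed` lint refuses restating a ★ head under a local name (F0P1c-p06 (g2) finding 2026-08-31 00:17:33Z), so the registry's chain is
RE-HOMED here with EVERY letter replaced by its ★ body and NO letter restated — ONE theorem:

* `HDel_holds` — the crux decl BY NAME.  Proof = the registry's two steps for (F) ([MumfordFogartyKirwan1994] Thm. 7.9 «for `n` large»: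
  ★ F-12-of-cores ED. 3 `exists_threshold_siegelFineModuliScheme_of_cores''` fed, in its binder order, CORE II = ★
  `AbelianSchemeOver.exists_groupLawLocus_of_projective` ([MFK94] Prop. 6.16 ∕ Thm. 6.14 step (II)), CORE F3 = ★ `F3DualAbelianScheme.stub_F3_holds`
  ([MFK94] Cor. 6.8: dual pairs Zariski-locally of projective abelian schemes), CORE PL = ★ `F13PluckerProducer.stub_PL_of_cores_holds'` at
  (II, F3) ([MFK94] Prop. 7.4 + §7.2 (*): the Plücker letter of the linearly rigidified covariant), CORE F11 = ★ `F11SmoothRoadA.stub_F11_holds`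
  ([Lan13] Prop. 2.2.4.4 ∕ Thm. 2.2.4.14: smoothness over `ℚ` by the deformation road); then ★ F-10 LEVEL DESCENT
  `lan2013_siegelFineModuliScheme_of_large_levels β h` (the remark after [MFK94] Thm. 7.9 «true even if `n ≥ 3`», Lemma 7.11; [Lan13]
  Cor. 1.4.1.12)), giving the named fact ★ `lan2013_siegelFineModuliScheme` ([Lan13] Thm. 1.4.1.11 + Cor. 7.2.3.9) as a TERM (inlined — not
  declared, so this file and the FLOOR-0 socket twin `Theorems/F0HFOfSiegelModuli.lean` (item F0HF, B-p01) cannot `dedup` each other), and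
  finally the ★ E-road junction `EquidimRelDimOfF.HDel_of_F_E : (F) → HDel` (p755621; (F) ⇒ (F′) relative dimension `g(g+1)/2` by proof ⇒ (U)
  complex uniformisation `UOfF` ⇒ M1′ `M1primeOfFU` ⇒ #60 `SiegelS1` by route ξ′ `MumfordRouteXiAssembly` ⇒ the Q-architecture receptacle
  `HDel_of_receptacle` ∘ `QArch.ambientReceptacle_of'` over the ★ stubs frame ∕ S2inj ∕ S2pair ∕ period chart ∕ Borel ∕ Squot ∕ S4 — all
  sorry-free in the tree; the same junction the P1 head line `Cruxes/HDel/Lines/F0_SiegelModuli.lean` ED. 1.7R uses for its `HDel_holds`).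
  Term = the P1 head's `HDel_holds` with the line's four core theorems replaced by their ★ bodies.

0 `def`, 0 `instance`, 0 `notation`, 0 `axiom`, 0 `sorry`; one theorem; imports Theorems ∕ Literature ∕ HarnessLib only.  Namespace
`Summit.HodgeConjecture.HodgeConjecture.Theorems.HCCMUnconditionalHDelOfF0` (file-named, as ★ `Theorems.F0FloorSockets`; no clash with the registry
namespace `…Cruxes.HypDel.F1ExtHodgeType` or the P1 head's `…Cruxes.HypDel.F0SiegelModuli`).  Filed `--kind proof --workitem stmt-HodgeConjecture-24835`
(director g14 s418 FOLLOW-ON «one closer per item»; author F0P1c-p06, second leg B-p01); the item is then released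
`--by Summit.HodgeConjecture.HodgeConjecture.Theorems.HCCMUnconditionalHDelOfF0.HDel_holds`.
-/

set_option autoImplicit false


namespace Summit.HodgeConjecture.HodgeConjecture.Theorems.HCCMUnconditionalHDelOfF0

-- the mandated namespace has the single-problem summit's repeated segment (`HodgeConjecture.HodgeConjecture`)
set_option linter.dupNamespace false in
/-- **`HDel` — the crux of item stmt-HodgeConjecture-24835 — IS A THEOREM** ([Deligne1979ShimuraVarieties, 2.2.5 ∕ Cor. 2.7.21] for the tree's
unitary Shimura datum, binder `hDel` of the printed-citation form of HC_CM): from the four ★ cores of the Siegel fine moduli programme —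
CORE II ★ `AbelianSchemeOver.exists_groupLawLocus_of_projective`, CORE F3 ★ `F3DualAbelianScheme.stub_F3_holds`, CORE PL ★
`F13PluckerProducer.stub_PL_of_cores_holds'` (at II, F3), CORE F11 ★ `F11SmoothRoadA.stub_F11_holds` — through ★ F-12-of-cores ED. 3
`exists_threshold_siegelFineModuliScheme_of_cores''` ([MumfordFogartyKirwan1994] Thm. 7.9 «for `n` large») and ★ F-10 level descent
`lan2013_siegelFineModuliScheme_of_large_levels` (the remark after Thm. 7.9), which give (F) = ★ `lan2013_siegelFineModuliScheme`
([Lan2013PELCompactifications] Thm. 1.4.1.11 + Cor. 7.2.3.9) as a term, and then the ★ E-road junction `EquidimRelDimOfF.HDel_of_F_E`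
((F) ⇒ relative dimension `g(g+1)/2` ⇒ complex uniformisation ⇒ Mumford's moduli interpretation on points ⇒ [Deligne1971TravauxShimura]
Thm. 4.21 `SiegelS1` by route ξ′ ⇒ the Q-architecture receptacle for the unitary datum, every input a ★ theorem of the tree).
HC_CM is proved only modulo the 7 printed citations until rung 0 closes; this theorem discharges the citation `hDel`.
[cite: Deligne1979ShimuraVarieties, 2.2.5 and Cor. 2.7.21] [cite: Deligne1971TravauxShimura, 4.16–4.21 pp. 150–152]
[cite: MumfordFogartyKirwan1994, Ch. 7 §3 Theorem 7.9 with the remark following it and Theorem 7.10 (p. 139); App. 7A]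
[cite: Lan2013PELCompactifications, Thm. 1.4.1.11 (p. 91) and Cor. 7.2.3.9 (p. 518)] [cite: Milne2005ShimuraVarieties, Thm. 6.11; Prop. 14.12 (p. 125)] -/
theorem HDel_holds : Summit.HodgeConjecture.HodgeConjecture.Theses.HCCMUnconditional.HDel := by
  -- [MFK94] Thm. 7.9 «for `n` large»: the threshold `β` and the fine moduli carriers at every level `N ≥ β g δ`, from the four ★ cores
  obtain ⟨β, h⟩ :=
    Literature.AlgebraicGeometry.ModuliOfAbelianVarieties.exists_threshold_siegelFineModuliScheme_of_cores''
      Literature.AlgebraicGeometry.AbelianSchemes.AbelianSchemeOver.exists_groupLawLocus_of_projective          -- CORE II  (★ p796432 F23)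
      Summit.HodgeConjecture.CorCM.Cruxes.HypDel.F3DualAbelianScheme.stub_F3_holds                               -- CORE F3  (★ p797885 T4)
      (Summit.HodgeConjecture.CorCM.Cruxes.HypDel.F13PluckerProducer.stub_PL_of_cores_holds'                     -- CORE PL  (★ p796000 F-13 twin ED. 2)
        Literature.AlgebraicGeometry.AbelianSchemes.AbelianSchemeOver.exists_groupLawLocus_of_projective
        Summit.HodgeConjecture.CorCM.Cruxes.HypDel.F3DualAbelianScheme.stub_F3_holds)
      Summit.HodgeConjecture.CorCM.Cruxes.HypDel.F11SmoothRoadA.stub_F11_holds                                   -- CORE F11 (★ p806948 F-11 END-GAME twin)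
  -- the remark after Thm. 7.9 «true even if `n ≥ 3`»: ★ F-10 level descent gives (F); then the ★ E-road junction (F) ⇒ `HDel`
  exact Summit.HodgeConjecture.HodgeConjecture.Theorems.EquidimRelDimOfF.HDel_of_F_E
    (Literature.AlgebraicGeometry.ModuliOfAbelianVarieties.lan2013_siegelFineModuliScheme_of_large_levels β h)

end Summit.HodgeConjecture.HodgeConjecture.Theorems.HCCMUnconditionalHDelOfF0
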